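import Summits.NavierStokesRegularity.NavierStokesRegularity.Theorems.ScenarioCensusAncientPlanarSymmetry
import HarnessLib

/-!
# Blow-up scenario census, block A: the 2.5D cell under a time-Type-I bound (row A7c)

Cell `pub/ns-census` (director-ns KEY req102, D-0154 (A), 2026-08-28), typer seat `ns-census-typer-2`
(generation 4). Companion of `ScenarioCensusAncientPlanarSymmetry.lean` (`row_A7_excluded`). Census row A7a
(= `Row_A7t`, `ScenarioCensusAncientSymmetry.lean`) is the Type-I-RATE 2.5D cell in the CONTINUOUS
Oseen-mild class of KNSS 2009, proof of Thm 6.2 (conclusion `W ≡ 0`, `KNSS2009_typeI_rate_liouville_holds`).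
This file types and closes its twin in the census's class of record, the duality form with measurable slices:

* `Row_A7c` / `row_A7c_excluded` — (TIME-only Type I `‖u(t, x)‖ ≤ C/√(−t)` · 2.5D · ancient mild `ν = 1`,
  measurable slices): every slice is a.e. constant — time shifts of a Type-I ancient mild solution are
  bounded ancient mild solutions (`IsAncientMildSolution.time_translate`), then `row_A7_excluded`. SHARP in
  this class: `w(t, x) = (−t)^{−1/2} e₃` is such a solution with non-zero constant slices
  (`not_helical_typeI_liouville_zero_form`, `ScenarioCensusHelicalSharp.lean`). Value: EXCLUDED-IN-TREE.

No summit statement is proved or claimed here; nothing in this file is a claim about Navier–Stokes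
regularity.
-/

noncomputable section

set_option linter.dupNamespace false

open MeasureTheory Set Filter Topology

namespace Summit.NavierStokesRegularity.NavierStokesRegularity.Theorems.ScenarioCensus

open Literature.Analysis Literature.Analysis.FluidPDE

/-- Census row A7c — time-Type-I twin of A7 in the duality class (TIME-only Type I `‖u(t, x)‖ ≤ C/√(−t)` ·
2.5D: `u(t, x + δ e₃) = u(t, x)` · ancient mild `ν = 1`, measurable slices): every slice is a.e. constant.
SHARP in this class: the spatially constant Type-I field `w(t, x) = (−t)^{−1/2} e₃` is such a solution
(`not_helical_typeI_liouville_zero_form`, `ScenarioCensusHelicalSharp.lean`), so "a.e. constant" cannot be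
improved to `u ≡ 0` (contrast census A7a = `Row_A7t`, continuous Oseen-mild class, conclusion `W ≡ 0`).
Value: EXCLUDED-IN-TREE (`row_A7c_excluded`). -/
def Row_A7c : Prop :=
  ∀ u : ℝ → EuclideanSpace ℝ (Fin 3) → EuclideanSpace ℝ (Fin 3), FluidPDE.IsAncientMildSolution 1 u →
    (∀ t < 0, AEStronglyMeasurable (u t) volume) →
      (∀ t < 0, ∀ (x : EuclideanSpace ℝ (Fin 3)) (δ : ℝ),
          u t (x + δ • EuclideanSpace.single 2 (1 : ℝ)) = u t x) →
        (∃ C : ℝ, FluidPDE.HasTypeITimeDecay C u) →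
          ∀ t < 0, ∃ b : EuclideanSpace ℝ (Fin 3), u t =ᵐ[volume] fun _ => b

/-- A7c is EXCLUDED-IN-TREE: shift time by `t/2` so that the solution is bounded on `(−∞, 0)`
(`IsAncientMildSolution.time_translate`; the Type-I bound gives `‖u‖ ≤ C/√(−t/2)` there), and apply
`row_A7_excluded`. -/
theorem row_A7c_excluded : Row_A7c := by
  intro u hu hmeas hinv hdec t ht
  obtain ⟨C, hC⟩ := hdec
  set s : ℝ := t / 2 with hs_def
  have hs : s < 0 := by rw [hs_def]; linarith
  have hsqrt : 0 < Real.sqrt (-s) := Real.sqrt_pos.2 (by linarith)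
  have hC0 : 0 ≤ C := by
    have h0 := (norm_nonneg _).trans (hC s hs 0)
    rwa [le_div_iff₀ hsqrt, zero_mul] at h0
  set v : ℝ → EuclideanSpace ℝ (Fin 3) → EuclideanSpace ℝ (Fin 3) := fun τ => u (τ + s) with hv_def
  have hv : FluidPDE.IsBoundedAncientMildSolution 1 v := by
    refine ⟨hu.time_translate hs.le, C / Real.sqrt (-s), fun τ hτ x => ?_⟩
    have hτ' : τ < 0 := mem_Iio.1 hτ
    have h1 := hC (τ + s) (by linarith) x
    have h2 : Real.sqrt (-s) ≤ Real.sqrt (-(τ + s)) := Real.sqrt_le_sqrt (by linarith)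
    exact h1.trans (div_le_div_of_nonneg_left hC0 hsqrt h2)
  have hvmeas : ∀ τ < 0, AEStronglyMeasurable (v τ) volume := fun τ hτ => hmeas (τ + s) (by linarith)
  have hvinv : ∀ τ < 0, ∀ (x : EuclideanSpace ℝ (Fin 3)) (δ : ℝ),
      v τ (x + δ • EuclideanSpace.single 2 (1 : ℝ)) = v τ x := fun τ hτ x δ =>
    hinv (τ + s) (by linarith) x δ
  obtain ⟨b, hb⟩ := row_A7_excluded v hv hvmeas hvinv (t - s) (by rw [hs_def]; linarith)
  have hvt : v (t - s) = u t := by simp [hv_def]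
  rw [hvt] at hb
  exact ⟨b, hb⟩

/-! ## Appendix (append-only round 2): the sub-cell where the OPEN cells A8 (helical) and A5 (axisymmetric
with swirl) meet is EXCLUDED — a helical AND axisymmetric field is `2½`-dimensional -/

/-- **A screw-invariant axisymmetric field is invariant under the axial translations**: compose the screw
motion by `θ = δ/h` with the rotation by `−θ` (pitch `h ≠ 0`). -/
theorem axial_invariant_of_helical_of_isAxisymmetric {h : ℝ} (hh : h ≠ 0)
    {v : EuclideanSpace ℝ (Fin 3) → EuclideanSpace ℝ (Fin 3)}
    (hhel : ∀ (θ : ℝ) (x : EuclideanSpace ℝ (Fin 3)),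
      v (FluidPDE.rotZ θ x + (h * θ) • EuclideanSpace.single 2 (1 : ℝ)) = FluidPDE.rotZ θ (v x))
    (haxi : FluidPDE.IsAxisymmetric v) :
    ∀ (x : EuclideanSpace ℝ (Fin 3)) (δ : ℝ), v (x + δ • EuclideanSpace.single 2 (1 : ℝ)) = v x := by
  intro x δ
  have hmul : h * (δ / h) = δ := by field_simp
  have key := hhel (δ / h) (FluidPDE.rotZ (-(δ / h)) x)
  rw [← FluidPDE.rotZ_add, add_neg_cancel, FluidPDE.rotZ_zero, hmul] at key
  rw [key, haxi (-(δ / h)) x, ← FluidPDE.rotZ_add, add_neg_cancel, FluidPDE.rotZ_zero]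

/-- Census sub-cell A8 ∩ A5 (key suggestion A8ax) — (any bounded type · HELICAL with pitch `h ≠ 0` AND
axisymmetric, swirl allowed · bounded ancient mild `ν = 1`, measurable slices): every slice is a.e. an AXIAL
constant `β(t) e_z`. Such a field is invariant under the axial translations
(`axial_invariant_of_helical_of_isAxisymmetric`), i.e. `2½`-dimensional, so `row_A7_excluded` applies, and
the constant is axial by `exists_eq_smul_eZ_of_isAxisymmetric_of_ae_eq_const`. Both ambient cells A8 (helical,
`Row_A8`) and A5 (axisymmetric with swirl) are OPEN; this is exactly where they meet. Value: EXCLUDED-IN-TREE. -/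
def Row_A8ax : Prop :=
  ∀ h : ℝ, h ≠ 0 → ∀ u : ℝ → EuclideanSpace ℝ (Fin 3) → EuclideanSpace ℝ (Fin 3),
    FluidPDE.IsBoundedAncientMildSolution 1 u → (∀ t < 0, AEStronglyMeasurable (u t) volume) →
      (∀ t < 0, ∀ (θ : ℝ) (x : EuclideanSpace ℝ (Fin 3)),
          u t (FluidPDE.rotZ θ x + (h * θ) • EuclideanSpace.single 2 (1 : ℝ)) =
            FluidPDE.rotZ θ (u t x)) →
        (∀ t < 0, FluidPDE.IsAxisymmetric (u t)) →
          ∀ t < 0, ∃ β : ℝ, u t =ᵐ[volume] fun _ => β • FluidPDE.eZ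

/-- A8ax is EXCLUDED-IN-TREE (`row_A7_excluded` on the axially invariant field, then the axial form of the
constant). -/
theorem row_A8ax_excluded : Row_A8ax := by
  intro h hh u hu hmeas hhel haxi t ht
  have hinv : ∀ s < 0, ∀ (x : EuclideanSpace ℝ (Fin 3)) (δ : ℝ),
      u s (x + δ • EuclideanSpace.single 2 (1 : ℝ)) = u s x := fun s hs =>
    axial_invariant_of_helical_of_isAxisymmetric hh (hhel s hs) (haxi s hs)
  obtain ⟨b, hb⟩ := row_A7_excluded u hu hmeas hinv t ht
  obtain ⟨β, rfl⟩ := exists_eq_smul_eZ_of_isAxisymmetric_of_ae_eq_const (haxi t ht) hb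
  exact ⟨β, hb⟩

/-- Census sub-cell A8t ∩ axisymmetric (key suggestion A8tax) — (TIME-only Type I `‖u(t, x)‖ ≤ C/√(−t)` ·
HELICAL with pitch `h ≠ 0` AND axisymmetric · ancient mild `ν = 1`, measurable slices): every slice is a.e.
an axial constant `β(t) e_z` (`row_A7c_excluded` on the axially invariant field). The typed OPEN target
`Row_A8t` drops the axisymmetry; the «pitch-defect» line's period-averaged field (z-independent and
axisymmetric) lies in this EXCLUDED sub-cell. Sharp: `w = (−t)^{−1/2} e₃` (`row_R8t_witness`). -/
def Row_A8tax : Prop :=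
  ∀ h : ℝ, h ≠ 0 → ∀ u : ℝ → EuclideanSpace ℝ (Fin 3) → EuclideanSpace ℝ (Fin 3),
    FluidPDE.IsAncientMildSolution 1 u → (∀ t < 0, AEStronglyMeasurable (u t) volume) →
      (∀ t < 0, ∀ (θ : ℝ) (x : EuclideanSpace ℝ (Fin 3)),
          u t (FluidPDE.rotZ θ x + (h * θ) • EuclideanSpace.single 2 (1 : ℝ)) =
            FluidPDE.rotZ θ (u t x)) →
        (∀ t < 0, FluidPDE.IsAxisymmetric (u t)) → (∃ C : ℝ, FluidPDE.HasTypeITimeDecay C u) →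
          ∀ t < 0, ∃ β : ℝ, u t =ᵐ[volume] fun _ => β • FluidPDE.eZ

/-- A8tax is EXCLUDED-IN-TREE. -/
theorem row_A8tax_excluded : Row_A8tax := by
  intro h hh u hu hmeas hhel haxi hdec t ht
  have hinv : ∀ s < 0, ∀ (x : EuclideanSpace ℝ (Fin 3)) (δ : ℝ),
      u s (x + δ • EuclideanSpace.single 2 (1 : ℝ)) = u s x := fun s hs =>
    axial_invariant_of_helical_of_isAxisymmetric hh (hhel s hs) (haxi s hs)
  obtain ⟨b, hb⟩ := row_A7c_excluded u hu hmeas hinv hdec t ht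
  obtain ⟨β, rfl⟩ := exists_eq_smul_eZ_of_isAxisymmetric_of_ae_eq_const (haxi t ht) hb
  exact ⟨β, hb⟩

end Summit.NavierStokesRegularity.NavierStokesRegularity.Theorems.ScenarioCensus

end
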